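import Mathlib

/-!
# T5CompactFactor — the compact place `τ′₁` of (N4.3.P3): `c₁ = 1`

Kernel form of the `j = 1` case of (N4.3.P3) in route/T5-N4-p5.md (owner p5): at `τ′₁` the
group `H₁ = U(W_A)(ℝ)_{τ′₁} = U(2)` is compact, `π₀,τ′₁ = det^{(m′₁−3)/2}` is a character
(N4.3.P2), and with the probability Haar measure
  `∫_{U(2)} |⟨π₀(g) f, f⟩|² dg = ∫_{U(2)} |det(g)^{m} ‖f‖²|² dg = ‖f‖⁴`,
because `|det g| = 1` for unitary `g`. Hence `Z_{τ′₁}(1/2) = ‖φ‖² ‖f‖² · c₁` with `c₁ = 1`.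

Contents (Mathlib only): `norm_eq_one_of_mem_unitary` (`|z| = 1` for `z ∈ unitary ℂ`),
`norm_det_eq_one` / `norm_det_zpow_eq_one` (`|det g| = |det(g)^m| = 1` for `g` in the unitary
group), `normSq_character_coeff` (the pointwise identity `|det(g)^m · c|² = |c|²`), and the
integral: over ANY probability measure on ANY measurable space `G` carrying a map `ρ : G → U(n)`,
`∫ |det(ρ g)^m · c|² = |c|²` (`integral_normSq_det_zpow`); the abstract version
`integral_normSq_unimodular` for any unimodular `χ`. Nothing about the Haar measure of `U(2)`
beyond «a probability measure» is used or formalised.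
-/

namespace Summit.Ventures.HodgeRepro2.T5CompactFactor

open MeasureTheory

/-- `‖z‖ = 1` for `z ∈ unitary ℂ`. -/
theorem norm_eq_one_of_mem_unitary {z : ℂ} (hz : z ∈ unitary ℂ) : ‖z‖ = 1 := by
  have h : star z * z = 1 := Unitary.star_mul_self_of_mem hz
  have h2 : ((Complex.normSq z : ℝ) : ℂ) = 1 := by
    rw [Complex.normSq_eq_conj_mul_self]
    exact h
  have h3 : Complex.normSq z = 1 := by exact_mod_cast h2
  rw [Complex.normSq_eq_norm_sq] at h3
  exact (pow_eq_one_iff_of_nonneg (norm_nonneg z) two_ne_zero).mp h3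

/-- `|det g| = 1` for `g` in the unitary group. -/
theorem norm_det_eq_one {n : Type*} [Fintype n] [DecidableEq n] {g : Matrix n n ℂ}
    (hg : g ∈ Matrix.unitaryGroup n ℂ) : ‖g.det‖ = 1 :=
  norm_eq_one_of_mem_unitary (Matrix.det_of_mem_unitary hg)

/-- `|det(g)^m| = 1` for `g` in the unitary group and `m ∈ ℤ`. -/
theorem norm_det_zpow_eq_one {n : Type*} [Fintype n] [DecidableEq n] {g : Matrix n n ℂ}
    (hg : g ∈ Matrix.unitaryGroup n ℂ) (m : ℤ) : ‖g.det ^ m‖ = 1 := by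
  rw [norm_zpow, norm_det_eq_one hg, one_zpow]

/-- **The matrix coefficient of the character `det^m` on a vector with `⟨f, f⟩ = c`:**
`|det(g)^m · c|² = |c|²` for `g` unitary. -/
theorem normSq_character_coeff {n : Type*} [Fintype n] [DecidableEq n] {g : Matrix n n ℂ}
    (hg : g ∈ Matrix.unitaryGroup n ℂ) (m : ℤ) (c : ℂ) :
    ‖g.det ^ m * c‖ ^ 2 = ‖c‖ ^ 2 := by
  rw [norm_mul, norm_det_zpow_eq_one hg m, one_mul]

/-- **The integral over a probability measure of `|χ(g) c|²` with `|χ(g)| = 1` is `|c|²`.** -/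
theorem integral_normSq_unimodular {G : Type*} [MeasurableSpace G] (μ : Measure G)
    [IsProbabilityMeasure μ] (χ : G → ℂ) (hχ : ∀ g, ‖χ g‖ = 1) (c : ℂ) :
    ∫ g, ‖χ g * c‖ ^ 2 ∂μ = ‖c‖ ^ 2 := by
  have hfun : (fun g => ‖χ g * c‖ ^ 2) = fun _ => ‖c‖ ^ 2 := by
    funext g
    rw [norm_mul, hχ g, one_mul]
  rw [hfun, integral_const]
  simp

/-- **(N4.3.P3), `j = 1`: `∫_{U(2)} |⟨π₀(g) f, f⟩|² dg = ‖f‖⁴`** for the character `det^m` on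
a compact group with its probability Haar measure: for ANY measurable space `G`, ANY
probability measure `μ` on it and ANY map `ρ : G → U(n)`,
`∫ |det(ρ g)^m · c|² dμ = |c|²` (with `c = ‖f‖²`: `= ‖f‖⁴`). -/
theorem integral_normSq_det_zpow {G : Type*} [MeasurableSpace G] (μ : Measure G)
    [IsProbabilityMeasure μ] {n : Type*} [Fintype n] [DecidableEq n] (ρ : G → Matrix n n ℂ)
    (hρ : ∀ g, ρ g ∈ Matrix.unitaryGroup n ℂ) (m : ℤ) (c : ℂ) :
    ∫ g, ‖(ρ g).det ^ m * c‖ ^ 2 ∂μ = ‖c‖ ^ 2 :=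
  integral_normSq_unimodular μ (fun g => (ρ g).det ^ m) (fun g => norm_det_zpow_eq_one (hρ g) m) c

/-- The same with `c = ‖f‖²` real: the value is `‖f‖⁴`. -/
theorem integral_normSq_det_zpow_normSq {G : Type*} [MeasurableSpace G] (μ : Measure G)
    [IsProbabilityMeasure μ] {n : Type*} [Fintype n] [DecidableEq n] (ρ : G → Matrix n n ℂ)
    (hρ : ∀ g, ρ g ∈ Matrix.unitaryGroup n ℂ) (m : ℤ) (r : ℝ) :
    ∫ g, ‖(ρ g).det ^ m * ((r ^ 2 : ℝ) : ℂ)‖ ^ 2 ∂μ = r ^ 4 := by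
  rw [integral_normSq_det_zpow μ ρ hρ m]
  rw [Complex.norm_real, Real.norm_eq_abs, abs_of_nonneg (sq_nonneg r)]
  ring

end Summit.Ventures.HodgeRepro2.T5CompactFactor
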